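import Literature.NumberTheory.Automorphic.ProductGroupTensorHomMultiplicity
import Literature.NumberTheory.Automorphic.CompactGroupMultiplicitySpace
import Literature.NumberTheory.Automorphic.HilbertRepIsotypicMultiplicity
import HarnessLib

/-!
# `(π ⊗ σ)|_K` is `σ`-isotypic of multiplicity `dim π` — ANY groups

Topic `Literature/RepresentationTheory/CompactGroups` (continues `OuterTensorProduct`, `OuterTensorProductMultiplicity`);
theorems only, no definition, no named fact.

`OuterTensorProductMultiplicity` proved Bröcker–tom Dieck II (4.15)-style bookkeeping «`(π ⊗ σ)|_K ≅ (dim π) · σ`» —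
`Schur.isotypicComponent_outerTensor_restrict_inr = ⊤`, `Schur.multiplicity_outerTensor_restrict_inr = dim π` — for COMPACT
`K` through the character integral.  Here for ANY groups `G`, `K` (no topology used, no continuity): `π` unitary on a
finite-dimensional `E`, `σ` irreducible unitary on `F`.  Every slice `f ↦ v ⊗ f` is a `K`-map `σ → (π ⊗ σ)|_K`
(`ContRepresentation.comp_mk_mem_intertwiners_restrict_inr`, `ProductGroupTensorHomMultiplicity`), its range lies in the
isotype (`range_le_isotypicComponent_of_mem_intertwiners`, `CompactGroupMultiplicitySpace`), and pure tensors span; the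
multiplicity is then `dim(E ⊗ F) / dim F = dim E` (`IsUnitary.multiplicity_eq_finrank_div`, `HilbertRepIsotypicMultiplicity`).

* `one_mem_intertwiners` — `1 ∈ Hom(ρ, ρ)`;
* `mk_mem_intertwiners_outerTensor_restrict_inr` / `flip_mk_mem_intertwiners_outerTensor_restrict_inl` — the slices
  `f ↦ v ⊗ f`, `v ↦ v ⊗ f` are `K`- (resp. `G`-) maps;
* `isotypicComponent_outerTensor_restrict_inr_eq_top'` / `…_inl_eq_top'` — **`(π ⊗ σ)|_K` is purely `σ`-isotypic**
  (any groups; `σ` irreducible unitary, `π` unitary), and symmetrically;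
* `multiplicity_outerTensor_restrict_inr'` / `…_inl'` — **`mult(σ, (π ⊗ σ)|_K) = dim π`**, **`mult(π, (π ⊗ σ)|_G) = dim σ`**.

## References
* T. Bröcker, T. tom Dieck, *Representations of Compact Lie Groups*, GTM 98 (1985), II §1 PDF p. 69, Prop (4.14)–(4.15)
  PDF p. 80 [BrockerTomDieck1985].
* A. Deitmar, S. Echterhoff, *Principles of Harmonic Analysis*, 2nd ed. (2014), §7.3 Thm. 7.3.2, PDF p. 198 [DeitmarEchterhoff2014].

## Provenance
Lane `lit-hodgefound` (HOME `run/shared/lean/pub/lit-hodgefound/`), prover seat `lit-hodgefound-p05` generation 7 (Layer 0,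
beneath C2-08 / C2-10).
-/

noncomputable section

open ContinuousLinearMap
open Literature.RepresentationTheory.CompactGroups Literature.NumberTheory.Automorphic
open scoped InnerProductSpace TensorProduct

namespace ContRepresentation

section Slices

variable {G K : Type*} [Group G] [Group K]
variable {E F : Type*} [NormedAddCommGroup E] [InnerProductSpace ℂ E] [FiniteDimensional ℂ E]
  [NormedAddCommGroup F] [InnerProductSpace ℂ F] [FiniteDimensional ℂ F]
variable {π : ContRepresentation ℂ G E} {σ : ContRepresentation ℂ K F}

omit [FiniteDimensional ℂ E] in
/-- `1 ∈ Hom_G(ρ, ρ)`. [cite: BrockerTomDieck1985, II (4.1)] -/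
theorem one_mem_intertwiners {X : Type*} [NormedAddCommGroup X] [InnerProductSpace ℂ X] (ρ : ContRepresentation ℂ G X) :
    (1 : X →L[ℂ] X) ∈ Schur.intertwiners ρ ρ := fun g => by
  rw [ContinuousLinearMap.one_def, ContinuousLinearMap.comp_id, ContinuousLinearMap.id_comp]

omit [FiniteDimensional ℂ E] in
/-- **The slice `f ↦ v ⊗ f` is a `K`-map `σ → (π ⊗ σ)|_K`.** [cite: BrockerTomDieck1985, II Prop (4.14)] -/
theorem mk_mem_intertwiners_outerTensor_restrict_inr (v : E) :
    LinearMap.toContinuousLinearMap (TensorProduct.mk ℂ E F v) ∈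
      Schur.intertwiners σ ((π.outerTensor σ).restrict (MonoidHom.inr G K)) := by
  have h := comp_mk_mem_intertwiners_restrict_inr (U := π.outerTensor σ) (π := π) (τ := σ)
    (one_mem_intertwiners (π.outerTensor σ)) v
  rwa [ContinuousLinearMap.one_def, ContinuousLinearMap.id_comp] at h

omit [FiniteDimensional ℂ F] in
/-- **The slice `v ↦ v ⊗ f` is a `G`-map `π → (π ⊗ σ)|_G`.** [cite: BrockerTomDieck1985, II Prop (4.14)] -/
theorem flip_mk_mem_intertwiners_outerTensor_restrict_inl (f : F) :
    LinearMap.toContinuousLinearMap ((TensorProduct.mk ℂ E F).flip f) ∈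
      Schur.intertwiners π ((π.outerTensor σ).restrict (MonoidHom.inl G K)) := by
  intro g
  refine ContinuousLinearMap.ext fun v => ?_
  change (π.outerTensor σ) (g, (1 : K)) (v ⊗ₜ[ℂ] f) = π g v ⊗ₜ[ℂ] f
  rw [ContRepresentation.outerTensor_apply_tmul, map_one]
  rfl

end Slices

section Isotypic

variable {G K : Type*} [Group G] [Group K]
variable {E F : Type*} [NormedAddCommGroup E] [InnerProductSpace ℂ E] [FiniteDimensional ℂ E]
  [NormedAddCommGroup F] [InnerProductSpace ℂ F] [FiniteDimensional ℂ F]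
variable {π : ContRepresentation ℂ G E} {σ : ContRepresentation ℂ K F}

omit [FiniteDimensional ℂ E] [FiniteDimensional ℂ F] in
/-- `π ⊗ σ` restricted to `K` is unitary when `π`, `σ` preserve inner products. [cite: BrockerTomDieck1985, II Prop (4.14)] -/
theorem isUnitary_outerTensor_restrict_inr (hπu : ∀ (g : G) (v w : E), ⟪π g v, π g w⟫_ℂ = ⟪v, w⟫_ℂ)
    (hσu : ∀ (k : K) (v w : F), ⟪σ k v, σ k w⟫_ℂ = ⟪v, w⟫_ℂ) [CompleteSpace (E ⊗[ℂ] F)] :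
    ((π.outerTensor σ).restrict (MonoidHom.inr G K)).IsUnitary := by
  have hU : (π.outerTensor σ).IsUnitary :=
    ContRepresentation.isUnitary_iff_inner_map_map.mpr (ContRepresentation.inner_outerTensor_apply_apply π σ hπu hσu)
  exact fun k => hU (MonoidHom.inr G K k)

omit [FiniteDimensional ℂ E] [FiniteDimensional ℂ F] in
/-- The same for the restriction to `G`. [cite: BrockerTomDieck1985, II Prop (4.14)] -/
theorem isUnitary_outerTensor_restrict_inl (hπu : ∀ (g : G) (v w : E), ⟪π g v, π g w⟫_ℂ = ⟪v, w⟫_ℂ)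
    (hσu : ∀ (k : K) (v w : F), ⟪σ k v, σ k w⟫_ℂ = ⟪v, w⟫_ℂ) [CompleteSpace (E ⊗[ℂ] F)] :
    ((π.outerTensor σ).restrict (MonoidHom.inl G K)).IsUnitary := by
  have hU : (π.outerTensor σ).IsUnitary :=
    ContRepresentation.isUnitary_iff_inner_map_map.mpr (ContRepresentation.inner_outerTensor_apply_apply π σ hπu hσu)
  exact fun g => hU (MonoidHom.inl G K g)

/-- **`(π ⊗ σ)|_K` is purely `σ`-isotypic — ANY groups** (`σ` irreducible unitary, `π` unitary): every pure tensor `v ⊗ f`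
is in the range of the `K`-map `f ↦ v ⊗ f`, which lies in the isotype. (Compact `K`: `Schur.isotypicComponent_outerTensor_restrict_inr`.)
[cite: BrockerTomDieck1985, II Prop (4.14)] [cite: DeitmarEchterhoff2014, Thm. 7.3.2] -/
theorem isotypicComponent_outerTensor_restrict_inr_eq_top' [σ.toRepresentation.IsIrreducible]
    (hπu : ∀ (g : G) (v w : E), ⟪π g v, π g w⟫_ℂ = ⟪v, w⟫_ℂ) (hσu : ∀ (k : K) (v w : F), ⟪σ k v, σ k w⟫_ℂ = ⟪v, w⟫_ℂ) :
    (((π.outerTensor σ).restrict (MonoidHom.inr G K)).isotypicComponent σ).toSubmodule = ⊤ := by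
  haveI : CompleteSpace (E ⊗[ℂ] F) := FiniteDimensional.complete ℂ (E ⊗[ℂ] F)
  have hρu := isUnitary_outerTensor_restrict_inr (π := π) (σ := σ) hπu hσu
  refine eq_top_iff.mpr fun x _ => ?_
  induction x using TensorProduct.induction_on with
  | zero => exact Submodule.zero_mem _
  | tmul v f =>
    exact range_le_isotypicComponent_of_mem_intertwiners hρu hσu (mk_mem_intertwiners_outerTensor_restrict_inr (π := π) v)
      ⟨f, rfl⟩
  | add x y hx hy => exact Submodule.add_mem _ (hx Submodule.mem_top) (hy Submodule.mem_top)

/-- **`(π ⊗ σ)|_G` is purely `π`-isotypic — ANY groups** (`π` irreducible unitary, `σ` unitary).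
[cite: BrockerTomDieck1985, II Prop (4.14)] [cite: DeitmarEchterhoff2014, Thm. 7.3.2] -/
theorem isotypicComponent_outerTensor_restrict_inl_eq_top' [π.toRepresentation.IsIrreducible]
    (hπu : ∀ (g : G) (v w : E), ⟪π g v, π g w⟫_ℂ = ⟪v, w⟫_ℂ) (hσu : ∀ (k : K) (v w : F), ⟪σ k v, σ k w⟫_ℂ = ⟪v, w⟫_ℂ) :
    (((π.outerTensor σ).restrict (MonoidHom.inl G K)).isotypicComponent π).toSubmodule = ⊤ := by
  haveI : CompleteSpace (E ⊗[ℂ] F) := FiniteDimensional.complete ℂ (E ⊗[ℂ] F)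
  have hρu := isUnitary_outerTensor_restrict_inl (π := π) (σ := σ) hπu hσu
  refine eq_top_iff.mpr fun x _ => ?_
  induction x using TensorProduct.induction_on with
  | zero => exact Submodule.zero_mem _
  | tmul v f =>
    exact range_le_isotypicComponent_of_mem_intertwiners hρu hπu
      (flip_mk_mem_intertwiners_outerTensor_restrict_inl (σ := σ) f) ⟨v, rfl⟩
  | add x y hx hy => exact Submodule.add_mem _ (hx Submodule.mem_top) (hy Submodule.mem_top)

/-- **`mult(σ, (π ⊗ σ)|_K) = dim π` — ANY groups** (`σ` irreducible unitary, `π` unitary): the restriction is `σ`-isotypic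
of dimension `dim E · dim F`, and the multiplicity of an isotype is its dimension over `dim σ`
(`IsUnitary.multiplicity_eq_finrank_div`). (Compact `K`: `Schur.multiplicity_outerTensor_restrict_inr`.)
[cite: BrockerTomDieck1985, II Prop (4.14)] [cite: DeitmarEchterhoff2014, Thm. 7.3.2] -/
theorem multiplicity_outerTensor_restrict_inr' [σ.toRepresentation.IsIrreducible]
    (hπu : ∀ (g : G) (v w : E), ⟪π g v, π g w⟫_ℂ = ⟪v, w⟫_ℂ) (hσu : ∀ (k : K) (v w : F), ⟪σ k v, σ k w⟫_ℂ = ⟪v, w⟫_ℂ) :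
    ((π.outerTensor σ).restrict (MonoidHom.inr G K)).multiplicity σ = (Module.finrank ℂ E : ℕ∞) := by
  haveI : CompleteSpace (E ⊗[ℂ] F) := FiniteDimensional.complete ℂ (E ⊗[ℂ] F)
  haveI : Nontrivial F := IsSimpleModule.nontrivial (MonoidAlgebra ℂ K) σ.toRepresentation.asModule
  set ρ := (π.outerTensor σ).restrict (MonoidHom.inr G K) with hρ
  have hρu : ρ.IsUnitary := isUnitary_outerTensor_restrict_inr (π := π) (σ := σ) hπu hσu
  have htop : (ρ.isotypicComponent σ).toSubmodule = ⊤ := isotypicComponent_outerTensor_restrict_inr_eq_top' hπu hσu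
  have hdim : Module.finrank ℂ (ρ.isotypicComponent σ).toSubmodule = Module.finrank ℂ E * Module.finrank ℂ F := by
    rw [htop, finrank_top, Module.finrank_tensorProduct]
  rw [hρu.multiplicity_eq_finrank_div, hdim, Nat.mul_div_cancel _ Module.finrank_pos]

/-- **`mult(π, (π ⊗ σ)|_G) = dim σ` — ANY groups** (`π` irreducible unitary, `σ` unitary).
(Compact `G`: `Schur.multiplicity_outerTensor_restrict_inl`.) [cite: BrockerTomDieck1985, II Prop (4.14)]
[cite: DeitmarEchterhoff2014, Thm. 7.3.2] -/
theorem multiplicity_outerTensor_restrict_inl' [π.toRepresentation.IsIrreducible]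
    (hπu : ∀ (g : G) (v w : E), ⟪π g v, π g w⟫_ℂ = ⟪v, w⟫_ℂ) (hσu : ∀ (k : K) (v w : F), ⟪σ k v, σ k w⟫_ℂ = ⟪v, w⟫_ℂ) :
    ((π.outerTensor σ).restrict (MonoidHom.inl G K)).multiplicity π = (Module.finrank ℂ F : ℕ∞) := by
  haveI : CompleteSpace (E ⊗[ℂ] F) := FiniteDimensional.complete ℂ (E ⊗[ℂ] F)
  haveI : Nontrivial E := IsSimpleModule.nontrivial (MonoidAlgebra ℂ G) π.toRepresentation.asModule
  set ρ := (π.outerTensor σ).restrict (MonoidHom.inl G K) with hρ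
  have hρu : ρ.IsUnitary := isUnitary_outerTensor_restrict_inl (π := π) (σ := σ) hπu hσu
  have htop : (ρ.isotypicComponent π).toSubmodule = ⊤ := isotypicComponent_outerTensor_restrict_inl_eq_top' hπu hσu
  have hdim : Module.finrank ℂ (ρ.isotypicComponent π).toSubmodule = Module.finrank ℂ E * Module.finrank ℂ F := by
    rw [htop, finrank_top, Module.finrank_tensorProduct]
  rw [hρu.multiplicity_eq_finrank_div, hdim, Nat.mul_div_cancel_left _ Module.finrank_pos]

end Isotypic

end ContRepresentation

end
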